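import Mathlib
import HarnessLib
import Summits.Parity.BatemanHorn.Theorems.IsogenyRedeiSplitBlockJacobiCornerDefs
import Summits.Parity.BatemanHorn.Theorems.IsogenyRedeiSplitBlockJacobiCornerMbbBlock
import Summits.Parity.BatemanHorn.Theorems.IsogenyRedeiSplitBlockJacobiCornerMbbPieceII
import Summits.Parity.BatemanHorn.Theorems.IsogenyRedeiSplitBlockJacobiCornerMbbBoundsII
import Summits.Parity.BatemanHorn.Theorems.IsogenyRedeiSplitBlockJacobiCornerMbbVaughan

/-!
# `stub_mbb_of_boxInputs` (line `Sketch`, crux `SplitBlockJacobiCorner`, stmt-Parity-15002):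
# the two Type II pieces from K2′

For a box `(P₁,t] × (P₂,t']` of the corner (`P₁ ≤ P₂ ≤ 8P₁^{1+δ₀}`, `t ≤ 2P₁`, `t' ≤ 2P₂`) and a
frequency `h ≠ 0`, the expanded Type II pieces (`typeII_left_expand` / `typeII_right_expand` forms)
are bounded using K2′ = `ShortFactorTwistedTypeIIGen (1/4 + η/100) η` on every active dyadic block
(short factor on the smaller variable, `trilinear_body_swap`), the block lemma and the window count:

* `typeII_left_bound` — `‖T₁‖ ≤ 9L² (U·L²·Y₀ + (3P₁/U)·(L² D³ · 2P₂))`,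
* `typeII_right_bound` — `‖T₂‖ ≤ 9L² (U·L·L_I·Y₀ + (3P₂/U)·(L L_I D³ · 2P₁))`,

`Y₀ = 2·4^η X^{1−η}`, `L_I = (1 + D) L`, all size hypotheses explicit (discharged in `…Main`).
-/

noncomputable section

open Finset ArithmeticFunction
open scoped ArithmeticFunction.Moebius

namespace Summit.Parity.BatemanHorn.Cruxes.SplitBlockJacobiCorner.Sketch.MbbOfBoxInputs

open Summit.Parity.BatemanHorn.Cruxes.SplitBlockJacobi.CofactorRootDiscrepancy

/-- `y^{1−η} ≤ κ·4^η·X^{1−η}` for `y ∈ [X/4, κX]`, `η > 0`, `X > 0`, `κ > 0`. [folklore] -/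
theorem rpow_one_sub_le {y X η κ : ℝ} (hη : 0 < η) (hX : 0 < X) (hκ : 0 < κ) (h1 : X / 4 ≤ y)
    (h2 : y ≤ κ * X) : y ^ (1 - η) ≤ κ * 4 ^ η * X ^ (1 - η) := by
  have hy : 0 < y := lt_of_lt_of_le (by positivity) h1
  rw [Real.rpow_sub hy, Real.rpow_one, Real.rpow_sub hX, Real.rpow_one]
  rw [div_le_iff₀ (Real.rpow_pos_of_pos hy η)]
  have h3 : (X / 4) ^ η ≤ y ^ η := Real.rpow_le_rpow (by positivity) h1 hη.le
  rw [Real.div_rpow hX.le (by norm_num)] at h3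
  have h4 : (0 : ℝ) < 4 ^ η := by positivity
  have h5 : X ^ η ≤ 4 ^ η * y ^ η := by
    rw [div_le_iff₀ h4] at h3; linarith
  have hXη : 0 < X ^ η := Real.rpow_pos_of_pos hX η
  calc y ≤ κ * X := h2
    _ = κ * X / X ^ η * X ^ η := by field_simp
    _ ≤ κ * X / X ^ η * (4 ^ η * y ^ η) := by
        apply mul_le_mul_of_nonneg_left h5; positivity
    _ = κ * 4 ^ η * (X / X ^ η) * y ^ η := by ring

/-- `(MRT)^{1−η} ≤ Y₀ := 2·4^η X^{1−η}` for an active block: `P/4 < MR < t ≤ 2P`, `T` the other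
side, `X = P·T`. [folklore] -/
theorem block_rpow_le {M R T P t : ℕ} {η : ℝ} (hη : 0 < η) (hP : 0 < P) (hT : 0 < T)
    (hMR : M * R < t) (ht : t ≤ 2 * P) (hact : P < 4 * M * R) :
    ((M * R * T : ℕ) : ℝ) ^ (1 - η) ≤ 2 * 4 ^ η * ((P : ℝ) * T) ^ (1 - η) := by
  apply rpow_one_sub_le hη (by positivity) two_pos
  · push_cast
    have : (P : ℝ) < 4 * M * R := by exact_mod_cast hact
    have hT' : (0 : ℝ) < T := by exact_mod_cast hT
    nlinarith
  · push_cast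
    have : (M : ℝ) * R < t := by exact_mod_cast hMR
    have : (t : ℝ) ≤ 2 * P := by exact_mod_cast ht
    have hT' : (0 : ℝ) < T := by exact_mod_cast hT
    nlinarith

/-- `(dA·d'B)^{1−η} ≤ Z₀ := 4·4^η X^{1−η}` for a Type I box: `P/2 ≤ dA ≤ 2P`, `P'/2 ≤ d'B ≤ 2P'`,
`X = P·P'`. [folklore] -/
theorem box_rpow_le {y₁ y₂ P P' η : ℝ} (hη : 0 < η) (hP : 0 < P) (hP' : 0 < P')
    (h1 : P / 2 ≤ y₁) (h2 : y₁ ≤ 2 * P) (h3 : P' / 2 ≤ y₂) (h4 : y₂ ≤ 2 * P') :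
    (y₁ * y₂) ^ (1 - η) ≤ 4 * 4 ^ η * (P * P') ^ (1 - η) := by
  apply rpow_one_sub_le hη (by positivity) (by norm_num)
  · nlinarith
  · nlinarith

/-- **K2′ on an active block, either orientation.** Given K2′ (with threshold `N₂`) and the size
facts of an active block `(M, R)` against the third variable `T`, the K2′ body is `≤ Y₀` for all
unit coefficients. [folklore] -/
theorem K2_body_bound {c η : ℝ} {N₂ : ℕ}
    (hK2 : ∀ M R T : ℕ, N₂ ≤ M * R → N₂ ≤ T →
      (T : ℝ) ≤ ((M * R : ℕ) : ℝ) ^ (1 + η) → ((M * R : ℕ) : ℝ) ≤ (T : ℝ) ^ (1 + η) →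
      ((M * R * T : ℕ) : ℝ) ^ (η / 25) ≤ M → (M : ℝ) ≤ ((M * R * T : ℕ) : ℝ) ^ c →
        ∀ (α γ β : ℕ → ℂ), (∀ m, ‖α m‖ ≤ 1) → (∀ r, ‖γ r‖ ≤ 1) → (∀ q, ‖β q‖ ≤ 1) →
          ∀ k : ℤ, k ≠ 0 → (|k| : ℝ) ≤ ((M * R * T : ℕ) : ℝ) ^ (η / 25) →
            ‖shortFactorTrilinearSum k α γ β M R T‖ ≤ ((M * R * T : ℕ) : ℝ) ^ (1 - η))
    (h : ℤ) (hh : h ≠ 0) (M R T : ℕ) {Y₀ : ℝ}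
    (hN : N₂ ≤ M * R) (hNT : N₂ ≤ T) (h1 : (T : ℝ) ≤ ((M * R : ℕ) : ℝ) ^ (1 + η))
    (h2 : ((M * R : ℕ) : ℝ) ≤ (T : ℝ) ^ (1 + η))
    (h3 : ((M * R * T : ℕ) : ℝ) ^ (η / 25) ≤ min M R)
    (h4 : ((min M R : ℕ) : ℝ) ≤ ((M * R * T : ℕ) : ℝ) ^ c)
    (h5 : (|h| : ℝ) ≤ ((M * R * T : ℕ) : ℝ) ^ (η / 25))
    (hY : ((M * R * T : ℕ) : ℝ) ^ (1 - η) ≤ Y₀) :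
    ∀ α γ β : ℕ → ℂ, (∀ m, ‖α m‖ ≤ 1) → (∀ r, ‖γ r‖ ≤ 1) → (∀ q, ‖β q‖ ≤ 1) →
      ‖∑ m ∈ Ioc M (2 * M), ∑ r ∈ Ioc R (2 * R),
          ∑ q ∈ (Ioc T (2 * T)).filter (fun q : ℕ => q % 4 = 1 ∧ Nat.Coprime (m * r) q),
            α m * γ r * β q * (jacobiSym ((m * r : ℕ) : ℤ) q : ℂ) * rootWeylSum h (m * r * q)‖ ≤ Y₀ := by
  intro α γ β hα hγ hβ
  rcases le_total M R with hMR | hRM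
  · rw [min_eq_left hMR] at h3 h4
    have := hK2 M R T hN hNT h1 h2 (by exact_mod_cast h3) (by exact_mod_cast h4) α γ β hα hγ hβ h hh h5
    exact le_trans this hY
  · rw [min_eq_right hRM] at h3 h4
    have hN' : N₂ ≤ R * M := by rwa [mul_comm] at hN
    have e1 : ((R * M : ℕ) : ℝ) = ((M * R : ℕ) : ℝ) := by rw [mul_comm]
    have e2 : ((R * M * T : ℕ) : ℝ) = ((M * R * T : ℕ) : ℝ) := by rw [mul_comm R M]
    have := hK2 R M T hN' hNT (by rw [e1]; exact h1) (by rw [e1]; exact h2)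
      (by rw [e2]; exact_mod_cast h3) (by rw [e2]; exact_mod_cast h4) γ α β hγ hα hβ h hh (by rw [e2]; exact h5)
    rw [e2] at this
    unfold shortFactorTrilinearSum at this
    rw [← trilinear_body_swap] at this
    exact le_trans this hY


set_option maxHeartbeats 800000 in
/-- **The first Type II piece** (`typeII_left_expand` form) from K2′: all size facts explicit.
[folklore] -/
theorem typeII_left_bound {c η : ℝ} (hη : 0 < η) (hc : 0 ≤ c) {N₂ : ℕ}
    (hK2 : ∀ M R T : ℕ, N₂ ≤ M * R → N₂ ≤ T →
      (T : ℝ) ≤ ((M * R : ℕ) : ℝ) ^ (1 + η) → ((M * R : ℕ) : ℝ) ≤ (T : ℝ) ^ (1 + η) →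
      ((M * R * T : ℕ) : ℝ) ^ (η / 25) ≤ M → (M : ℝ) ≤ ((M * R * T : ℕ) : ℝ) ^ c →
        ∀ (α γ β : ℕ → ℂ), (∀ m, ‖α m‖ ≤ 1) → (∀ r, ‖γ r‖ ≤ 1) → (∀ q, ‖β q‖ ≤ 1) →
          ∀ k : ℤ, k ≠ 0 → (|k| : ℝ) ≤ ((M * R * T : ℕ) : ℝ) ^ (η / 25) →
            ‖shortFactorTrilinearSum k α γ β M R T‖ ≤ ((M * R * T : ℕ) : ℝ) ^ (1 - η))
    (h : ℤ) (hh : h ≠ 0) (U P₁ t P₂ t' : ℕ) {L D Y₀ : ℝ}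
    (hU : 1 ≤ U) (hP₁ : 0 < P₁) (hP₁P₂ : P₁ ≤ P₂) (ht : t ≤ 2 * P₁) (ht' : t' ≤ 2 * P₂)
    (hL1 : 1 ≤ L) (hD1 : 1 ≤ D)
    (hLn : ∀ n : ℕ, n ≤ 4 * (P₁ * P₂) → Real.log n ≤ L)
    (hDn : ∀ n : ℕ, n ≤ 4 * (P₁ * P₂) → (n.divisors.card : ℝ) ≤ D)
    (hI : ((Nat.log 2 t + 1 : ℕ) : ℝ) ≤ 3 * L)
    (hN₂ : 4 * N₂ ≤ P₁)
    (hA1 : (P₂ : ℝ) ≤ ((P₁ : ℝ) / 4) ^ (1 + η)) (hA2 : (2 * P₁ : ℝ) ≤ (P₂ : ℝ) ^ (1 + η))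
    (hS1 : (2 * ((P₁ : ℝ) * P₂)) ^ (η / 25) ≤ U)
    (hS2 : Real.sqrt (2 * P₁) ≤ (((P₁ : ℝ) * P₂) / 4) ^ c)
    (hfreq : (|h| : ℝ) ≤ (((P₁ : ℝ) * P₂) / 4) ^ (η / 25))
    (hY₀ : Y₀ = 2 * 4 ^ η * ((P₁ : ℝ) * P₂) ^ (1 - η)) :
    ‖∑ b ∈ Ioc 0 t, ∑ r ∈ Ioc 0 t,
        if P₁ < b * r ∧ b * r ≤ t then
          (if b % 4 = 1 then (((if U < b then (((μ b : ℤ)) : ℝ) else 0) : ℝ) : ℂ) else 0) *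
            (if r % 4 = 1 then (((∑ c ∈ Nat.divisors r, if U < c then Λ c else 0) : ℝ) : ℂ) else 0) *
            ∑ Q' ∈ (Ioc P₂ t').filter (fun Q' : ℕ => Q' % 4 = 1),
              ((Λ Q' : ℝ) : ℂ) * ((jacobiSym ((b * r : ℕ) : ℤ) Q' : ℂ) * rootWeylSum h (b * r * Q'))
        else 0‖ ≤
      9 * L ^ 2 * (U * (L * L * Y₀) + 3 * (P₁ : ℝ) / U * (L * L * D ^ 3 * (2 * P₂))) := by
  -- abbreviations
  set S' := (Ioc P₂ t').filter (fun Q' : ℕ => Q' % 4 = 1) with hS'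
  set g : ℕ → ℂ := fun Q' => ((Λ Q' : ℝ) : ℂ) with hg
  set F : ℕ → ℂ := fun n => (L : ℂ) * ∑ Q' ∈ S', g Q' * ((jacobiSym (n : ℤ) Q' : ℂ) * rootWeylSum h (n * Q'))
    with hF
  set a : ℕ → ℂ := fun b => if b % 4 = 1 then (((if U < b then (((μ b : ℤ)) : ℝ) else 0) : ℝ) : ℂ) else 0 with ha
  set cc : ℕ → ℂ := fun r => if r % 4 = 1 then (((∑ c ∈ Nat.divisors r, if U < c then Λ c else 0) : ℝ) : ℂ) else 0 with hcc
  set c' : ℕ → ℂ := fun r => (if r ≤ t then cc r else 0) / (L : ℂ) with hc'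
  have hL0 : 0 < L := by linarith
  have hLC : (L : ℂ) ≠ 0 := by exact_mod_cast hL0.ne'
  have hD0 : 0 ≤ D := by linarith
  have hP₂ : 0 < P₂ := lt_of_lt_of_le hP₁ hP₁P₂
  have hX0 : (0 : ℝ) < (P₁ : ℝ) * P₂ := by positivity
  have hY₀0 : 0 ≤ Y₀ := by rw [hY₀]; positivity
  have h4X : ∀ n : ℕ, n ≤ 2 * P₂ → n ≤ 4 * (P₁ * P₂) := fun n hn => by nlinarith
  have h4X' : ∀ n : ℕ, n ≤ 2 * P₁ → n ≤ 4 * (P₁ * P₂) := fun n hn => by nlinarith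
  -- coefficient facts
  have ha1 : ∀ b, ‖a b‖ ≤ 1 := by
    intro b; simp only [ha]
    by_cases h1 : b % 4 = 1
    · rw [if_pos h1, Complex.norm_real, Real.norm_eq_abs]
      by_cases h2 : U < b
      · rw [if_pos h2]; exact_mod_cast abs_moebius_le_one
      · rw [if_neg h2, abs_zero]; exact zero_le_one
    · rw [if_neg h1, norm_zero]; exact zero_le_one
  have ha0 : ∀ b, b ≤ U → a b = 0 := by
    intro b hb; simp only [ha]; rw [if_neg (not_lt.mpr hb)]; simp
  have hcc_le : ∀ r, r ≤ t → ‖cc r‖ ≤ L := by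
    intro r hr; simp only [hcc]
    split_ifs
    · rw [Complex.norm_real, Real.norm_eq_abs, abs_of_nonneg (lamU_nonneg U r)]
      exact (lamU_le_log U r).trans (hLn r (h4X' r (hr.trans ht)))
    · rw [norm_zero]; exact hL0.le
  have hc'1 : ∀ r, ‖c' r‖ ≤ 1 := by
    intro r; simp only [hc']
    rw [norm_div, Complex.norm_real, Real.norm_eq_abs, abs_of_pos hL0, div_le_one hL0]
    split_ifs with hr
    · exact hcc_le r hr
    · rw [norm_zero]; exact hL0.le
  have hc'0 : ∀ r, r ≤ U → c' r = 0 := by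
    intro r hr; simp only [hc', hcc]; rw [lamU_eq_zero_of_le hr]; simp
  have hg' : ∀ q ∈ S', ‖g q‖ ≤ L := by
    intro q hq
    have hq' := Finset.mem_Ioc.mp (Finset.mem_filter.mp hq).1
    simp only [hg]
    rw [Complex.norm_real, Real.norm_eq_abs, abs_of_nonneg vonMangoldt_nonneg]
    exact vonMangoldt_le_log.trans (hLn q (h4X q (hq'.2.trans ht')))
  have hDq : ∀ q ∈ S', (q.divisors.card : ℝ) ≤ D := by
    intro q hq
    have hq' := Finset.mem_Ioc.mp (Finset.mem_filter.mp hq).1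
    exact hDn q (h4X q (hq'.2.trans ht'))
  -- rewrite the piece in the form of `typeII_piece_bound`
  have hrw : (∑ b ∈ Ioc 0 t, ∑ r ∈ Ioc 0 t,
      if P₁ < b * r ∧ b * r ≤ t then
        (if b % 4 = 1 then (((if U < b then (((μ b : ℤ)) : ℝ) else 0) : ℝ) : ℂ) else 0) *
          (if r % 4 = 1 then (((∑ c ∈ Nat.divisors r, if U < c then Λ c else 0) : ℝ) : ℂ) else 0) *
          ∑ Q' ∈ S', ((Λ Q' : ℝ) : ℂ) * ((jacobiSym ((b * r : ℕ) : ℤ) Q' : ℂ) * rootWeylSum h (b * r * Q'))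
      else 0) =
      ∑ b ∈ Ioc 0 t, ∑ r ∈ Ioc 0 t, if P₁ < b * r ∧ b * r ≤ t then a b * c' r * F (b * r) else 0 := by
    refine Finset.sum_congr rfl fun b hb => Finset.sum_congr rfl fun r _ => ?_
    by_cases hcut : P₁ < b * r ∧ b * r ≤ t
    · rw [if_pos hcut, if_pos hcut]
      have hrt : r ≤ t := le_trans (Nat.le_mul_of_pos_left r (Finset.mem_Ioc.mp hb).1) hcut.2
      show a b * cc r * (∑ Q' ∈ S', g Q' * ((jacobiSym ((b * r : ℕ) : ℤ) Q' : ℂ) *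
        rootWeylSum h (b * r * Q'))) = a b * ((if r ≤ t then cc r else 0) / (L : ℂ)) *
          ((L : ℂ) * ∑ Q' ∈ S', g Q' * ((jacobiSym ((b * r : ℕ) : ℤ) Q' : ℂ) * rootWeylSum h (b * r * Q')))
      rw [if_pos hrt]
      generalize (∑ Q' ∈ S', g Q' * ((jacobiSym ((b * r : ℕ) : ℤ) Q' : ℂ) * rootWeylSum h (b * r * Q'))) = G'
      field_simp
    · rw [if_neg hcut, if_neg hcut]
  rw [hrw]
  -- dyadic depth
  set I := Nat.log 2 t + 1 with hIdef
  have hIt : t ≤ U * 2 ^ I :=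
    (Nat.lt_pow_succ_log_self one_lt_two t).le.trans (Nat.le_mul_of_pos_left _ hU)
  -- the block hypothesis from K2′
  have hblock : ∀ M R : ℕ, (∃ i < I, M = U * 2 ^ i) → (∃ j < I, R = U * 2 ^ j) →
      M * R < t → P₁ < 4 * M * R →
      ‖∑ m ∈ Ioc M (2 * M), ∑ r ∈ Ioc R (2 * R),
          (if P₁ < m * r ∧ m * r ≤ t then a m * c' r * F (m * r) else 0)‖ ≤
        U * (L * L * Y₀) + ∑ m ∈ Ioc M (2 * M), ∑ r ∈ Ioc R (2 * R),
          (if (P₁ < m * r ∧ m * r ≤ P₁ + P₁ / U) ∨ (m * r ≤ t ∧ t < m * r + t / U) then ‖F (m * r)‖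
            else 0) := by
    rintro M R ⟨i, hi, rfl⟩ ⟨j, hj, rfl⟩ hMRt hPMR
    refine block_bound F a c' ha1 hc'1 (U * 2 ^ i) (U * 2 ^ j) P₁ t U hU ?_
    refine typeII_H_of_K2 h g (U * 2 ^ i) (U * 2 ^ j) P₂ t' ht' hL0 hL0.le hg' ?_
    -- K2′ on this block
    have hMU : U ≤ U * 2 ^ i := Nat.le_mul_of_pos_right U (Nat.two_pow_pos i)
    have hRU : U ≤ U * 2 ^ j := Nat.le_mul_of_pos_right U (Nat.two_pow_pos j)
    set M := U * 2 ^ i with hM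
    set R := U * 2 ^ j with hR
    have hMRr : (P₁ : ℝ) / 4 ≤ ((M * R : ℕ) : ℝ) := by
      have : (P₁ : ℝ) < 4 * M * R := by exact_mod_cast hPMR
      push_cast; linarith
    have hMRr2 : ((M * R : ℕ) : ℝ) ≤ 2 * P₁ := by
      have : ((M * R : ℕ) : ℝ) < t := by exact_mod_cast hMRt
      have : (t : ℝ) ≤ 2 * P₁ := by exact_mod_cast ht
      linarith
    have hMRT1 : ((P₁ : ℝ) * P₂) / 4 ≤ ((M * R * P₂ : ℕ) : ℝ) := by
      push_cast
      have : (P₁ : ℝ) < 4 * M * R := by exact_mod_cast hPMR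
      have : (0 : ℝ) < P₂ := by exact_mod_cast hP₂
      nlinarith
    have hMRT2 : ((M * R * P₂ : ℕ) : ℝ) ≤ 2 * ((P₁ : ℝ) * P₂) := by
      push_cast
      have : (M : ℝ) * R ≤ 2 * P₁ := by exact_mod_cast hMRr2
      have : (0 : ℝ) < P₂ := by exact_mod_cast hP₂
      nlinarith
    have hMRT0 : (0 : ℝ) ≤ ((M * R * P₂ : ℕ) : ℝ) := Nat.cast_nonneg _
    refine K2_body_bound hK2 h hh M R P₂ ?_ ?_ ?_ ?_ ?_ ?_ ?_ ?_
    · -- N₂ ≤ M R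
      have : 4 * (M * R) = 4 * M * R := by ring
      omega
    · omega
    · exact hA1.trans (Real.rpow_le_rpow (by positivity) hMRr (by linarith))
    · exact hMRr2.trans hA2
    · -- short range, lower
      have hmin : (U : ℝ) ≤ ((min M R : ℕ) : ℝ) := by exact_mod_cast le_min hMU hRU
      refine le_trans ?_ hmin
      exact (Real.rpow_le_rpow hMRT0 hMRT2 (by positivity)).trans hS1
    · -- short range, upper
      have hmin2 : ((min M R : ℕ) : ℝ) ≤ Real.sqrt (2 * P₁) := by
        have hsq : ((min M R : ℕ) : ℝ) ^ 2 ≤ 2 * P₁ := by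
          have : min M R * min M R ≤ M * R := Nat.mul_le_mul (min_le_left _ _) (min_le_right _ _)
          have : ((min M R * min M R : ℕ) : ℝ) ≤ ((M * R : ℕ) : ℝ) := by exact_mod_cast this
          push_cast at this hMRr2 ⊢
          nlinarith
        exact Real.le_sqrt_of_sq_le hsq
      exact hmin2.trans (hS2.trans (Real.rpow_le_rpow (by positivity) hMRT1 hc))
    · exact hfreq.trans (Real.rpow_le_rpow (by positivity) hMRT1 (by positivity))
    · rw [hY₀]; exact block_rpow_le hη hP₁ hP₂ hMRt ht hPMR
  -- the window majorant
  have hΦ : ∀ n : ℕ, n ≤ 2 * P₁ → (n.divisors.card : ℝ) * ‖F n‖ ≤ L * L * D ^ 3 * S'.card := by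
    intro n hn
    exact typeII_Phi h g P₂ t' hL0.le hL0.le hD0 hg' hDq n (hDn n (h4X' n hn))
  have hΦ0 : 0 ≤ L * L * D ^ 3 * S'.card := by positivity
  have key := typeII_piece_bound F a c' U P₁ t U I hU ht hIt ha0 hc'0 (by positivity) hΦ0 hΦ hblock
  refine key.trans ?_
  -- numerical simplifications: `I ≤ 3L`, `P₁/U + t/U ≤ 3P₁/U`, `#S' ≤ 2P₂`
  have hI2 : (I : ℝ) ^ 2 ≤ 9 * L ^ 2 := by
    have hI0 : (0 : ℝ) ≤ I := Nat.cast_nonneg _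
    have : (I : ℝ) ≤ 3 * L := by rw [hIdef]; exact_mod_cast hI
    nlinarith
  have hW : ((P₁ / U + t / U : ℕ) : ℝ) ≤ 3 * (P₁ : ℝ) / U := by
    have hU0 : (0 : ℝ) < U := by exact_mod_cast hU
    push_cast
    have e1 : ((P₁ / U : ℕ) : ℝ) ≤ (P₁ : ℝ) / U := Nat.cast_div_le
    have e2 : ((t / U : ℕ) : ℝ) ≤ (t : ℝ) / U := Nat.cast_div_le
    have e3 : (t : ℝ) / U ≤ 2 * P₁ / U := by
      apply div_le_div_of_nonneg_right _ hU0.le; exact_mod_cast ht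
    calc _ ≤ (P₁ : ℝ) / U + 2 * P₁ / U := by linarith
      _ = 3 * (P₁ : ℝ) / U := by ring
  have hcard : (S'.card : ℝ) ≤ 2 * P₂ := by
    have h1 : S'.card ≤ (Ioc P₂ t').card := Finset.card_filter_le _ _
    have h2 : (Ioc P₂ t').card = t' - P₂ := Nat.card_Ioc _ _
    have h3 : S'.card ≤ 2 * P₂ := by omega
    have h4 : ((S'.card : ℕ) : ℝ) ≤ ((2 * P₂ : ℕ) : ℝ) := Nat.cast_le.mpr h3
    push_cast at h4
    exact h4
  have hU0 : (0 : ℝ) < U := by exact_mod_cast hU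
  have hin : (U : ℝ) * (L * L * Y₀) + ((P₁ / U + t / U : ℕ) : ℝ) * (L * L * D ^ 3 * S'.card) ≤
      U * (L * L * Y₀) + 3 * (P₁ : ℝ) / U * (L * L * D ^ 3 * (2 * P₂)) := by
    have h1 : ((P₁ / U + t / U : ℕ) : ℝ) * (L * L * D ^ 3 * S'.card) ≤
        (3 * (P₁ : ℝ) / U) * (L * L * D ^ 3 * (2 * P₂)) :=
      mul_le_mul hW (by gcongr) hΦ0 (by positivity)
    linarith
  have hin0 : 0 ≤ (U : ℝ) * (L * L * Y₀) + ((P₁ / U + t / U : ℕ) : ℝ) * (L * L * D ^ 3 * S'.card) := by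
    positivity
  calc (I : ℝ) ^ 2 * ((U : ℝ) * (L * L * Y₀) + ((P₁ / U + t / U : ℕ) : ℝ) * (L * L * D ^ 3 * S'.card))
      ≤ 9 * L ^ 2 * ((U : ℝ) * (L * L * Y₀) + ((P₁ / U + t / U : ℕ) : ℝ) * (L * L * D ^ 3 * S'.card)) :=
        mul_le_mul_of_nonneg_right hI2 hin0
    _ ≤ 9 * L ^ 2 * (U * (L * L * Y₀) + 3 * (P₁ : ℝ) / U * (L * L * D ^ 3 * (2 * P₂))) :=
        mul_le_mul_of_nonneg_left hin (by positivity)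


end Summit.Parity.BatemanHorn.Cruxes.SplitBlockJacobiCorner.Sketch.MbbOfBoxInputs

namespace Summit.Parity.BatemanHorn.Cruxes.SplitBlockJacobiCorner.Sketch

/-- **Registered stub form** (the uniform power bound `y^{1−η} ≤ κ 4^η X^{1−η}` on `[X/4, κX]`):
restated in `∀`-form in the crux-line namespace under the name registered on stmt-Parity-15002.
[folklore] -/
theorem mbbMainIIa_rpow_one_sub_le :
    ∀ y X η κ : ℝ, 0 < η → 0 < X → 0 < κ → X / 4 ≤ y → y ≤ κ * X → y ^ (1 - η) ≤ κ * 4 ^ η * X ^ (1 - η) :=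
  fun _ _ _ _ hη hX hκ h1 h2 => MbbOfBoxInputs.rpow_one_sub_le hη hX hκ h1 h2

end Summit.Parity.BatemanHorn.Cruxes.SplitBlockJacobiCorner.Sketch

end
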